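import Literature.Probability.MarkovChains.TotalVariation

/-!
HONEST FRAMING: exact (Metropolis-corrected) sampling algorithms for lattice gauge theory; figures
of merit are autocorrelation/cost numbers at stated couplings and volumes; no continuum-physics
claim.

# PartialLazyBinomialClock — A PARTIALLY LAZY CHAIN `qP + (1−q)I` IS `P` RUN AT A BINOMIAL CLOCK: `μ(qP + (1−q)I)ⁿ = Σ_j C(n,j)qʲ(1−q)ⁿ⁻ʲ·μPʲ`; AN EVENT WHOSE `δPʲ`-MASS IS
# `≥ c` FOR ALL `j ≤ N` KEEPS `‖δ(qP + (1−q)I)ⁿ − π‖_TV ≥ c(1 − nq/(N+1)) − π(A)` (Markov for the clock) (lean-2 GEN-45, ours)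

Venture-side (OURS).  Cell `lqcd-flow` (pub-lqcd), unit `pub-lqcd-lean-2-g45`, 2026-08-31.  Chapter AE, file 17 — generic bookkeeping for file 18 (chapter U's homogeneous scheme is the
idealised star at a binomial clock).  Def-free: the binomial weights are written `C(n,j)qʲ(1−q)ⁿ⁻ʲ` with Mathlib's `Nat.choose`; their mass (`add_pow`) and mean
(`Nat.add_one_mul_choose_eq`) are all that Markov's inequality needs.

* `stepLaw_partialLazy`, **`lawAt_partialLazy_choose`** (the binomial clock, Pascal's rule), `mass_partialLazy`, `choose_weights_sum`, `choose_weights_mean`, `choose_average_ge_of_head`,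
  **`partialLazy_mass_ge`**, `partialLazy_isRowStochastic`, **`partialLazy_tvDist_ge`**, `quarter_of_ge_260` (arithmetic for file 18).

Literature grade (cell rule): OWN, elementary [cite: LevinPeres2017, §5.3, proof of Proposition 5.7 (the lazy chain `(I+P)/2` at a `Bin(n,½)` clock)]; no new bib keys.
-/

noncomputable section

open Finset Function
open Literature.Probability.MarkovChains

namespace Summit.Ventures.LatticeQCDFlow.Scaling

/-! ## §1 Partially lazy chains run at a binomial clock -/

section PartialLazy
variable {Y : Type*} [Fintype Y] [DecidableEq Y]

/-- One step of `q·P + (1−q)·I`: `μ ↦ q·μP + (1−q)·μ`. [ours] -/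
theorem stepLaw_partialLazy (P : Y → Y → ℝ) (q : ℝ) (μ : Y → ℝ) :
    stepLaw (fun y z => q * P y z + (1 - q) * (if z = y then 1 else 0)) μ = fun z => q * stepLaw P μ z + (1 - q) * μ z := by
  funext z
  simp only [stepLaw]
  rw [show ∑ y, μ y * (q * P y z + (1 - q) * (if z = y then 1 else 0)) = q * ∑ y, μ y * P y z + (1 - q) * ∑ y, (if z = y then μ y else 0) by
    rw [mul_sum, mul_sum, ← sum_add_distrib]; exact sum_congr rfl fun y _ => by split_ifs <;> ring]
  rw [Finset.sum_ite_eq univ z]; simp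

/-- **THE BINOMIAL CLOCK:** `μ(qP + (1−q)I)ⁿ = Σ_{j ≤ n} C(n,j)qʲ(1−q)ⁿ⁻ʲ·μPʲ`. [ours; cf. LevinPeres2017 Prop. 5.7's proof for `q = ½`] -/
theorem lawAt_partialLazy_choose (P : Y → Y → ℝ) (q : ℝ) (μ : Y → ℝ) (n : ℕ) :
    lawAt (fun y z => q * P y z + (1 - q) * (if z = y then 1 else 0)) μ n
      = fun z => ∑ j ∈ range (n + 1), ((n.choose j : ℝ) * q ^ j * (1 - q) ^ (n - j)) * lawAt P μ j z := by
  induction n with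
  | zero => funext z; simp [lawAt_zero]
  | succ n ih =>
    funext z
    rw [lawAt_succ, ih, stepLaw_partialLazy]
    simp only []
    have hlin : stepLaw P (fun z => ∑ j ∈ range (n + 1), ((n.choose j : ℝ) * q ^ j * (1 - q) ^ (n - j)) * lawAt P μ j z) z
        = ∑ j ∈ range (n + 1), ((n.choose j : ℝ) * q ^ j * (1 - q) ^ (n - j)) * lawAt P μ (j + 1) z := by
      simp only [stepLaw, lawAt_succ]
      rw [show ∑ x, (∑ j ∈ range (n + 1), ((n.choose j : ℝ) * q ^ j * (1 - q) ^ (n - j)) * lawAt P μ j x) * P x z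
          = ∑ x, ∑ j ∈ range (n + 1), ((n.choose j : ℝ) * q ^ j * (1 - q) ^ (n - j)) * (lawAt P μ j x * P x z) by
        refine sum_congr rfl fun x _ => ?_
        rw [sum_mul]; exact sum_congr rfl fun j _ => by ring]
      rw [sum_comm]
      exact sum_congr rfl fun j _ => by rw [← mul_sum]
    rw [hlin]
    -- Pascal: `C(n+1,k+1) = C(n,k) + C(n,k+1)`; the `k = 0` term and the vanishing `C(n,n+1)` term
    symm
    rw [sum_range_succ']
    simp only [Nat.choose_zero_right, Nat.cast_one, one_mul, pow_zero, Nat.sub_zero]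
    have hP : ∀ k ∈ range (n + 1), (((n + 1).choose (k + 1) : ℕ) : ℝ) * q ^ (k + 1) * (1 - q) ^ (n + 1 - (k + 1)) * lawAt P μ (k + 1) z
        = q * (((n.choose k : ℕ) : ℝ) * q ^ k * (1 - q) ^ (n - k) * lawAt P μ (k + 1) z)
          + ((n.choose (k + 1) : ℕ) : ℝ) * q ^ (k + 1) * (1 - q) ^ (n - k) * lawAt P μ (k + 1) z := by
      intro k _
      rw [Nat.choose_succ_succ, Nat.cast_add, show n + 1 - (k + 1) = n - k from by omega]
      ring
    rw [sum_congr rfl hP, sum_add_distrib, ← mul_sum]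
    -- the second sum is `(1−q)·Σ_{j ≥ 1} w_j L_j`; its `k = n` term vanishes
    have h2 : ∑ k ∈ range (n + 1), ((n.choose (k + 1) : ℕ) : ℝ) * q ^ (k + 1) * (1 - q) ^ (n - k) * lawAt P μ (k + 1) z
        = (1 - q) * ∑ k ∈ range n, ((n.choose (k + 1) : ℕ) : ℝ) * q ^ (k + 1) * (1 - q) ^ (n - (k + 1)) * lawAt P μ (k + 1) z := by
      rw [sum_range_succ, Nat.choose_succ_self, Nat.cast_zero, zero_mul, zero_mul, zero_mul, add_zero, mul_sum]
      refine sum_congr rfl fun k hk => ?_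
      have hk' : k < n := mem_range.mp hk
      rw [show n - k = (n - (k + 1)) + 1 from by omega, pow_succ]
      ring
    rw [h2]
    have h3 : (1 - q) * ∑ j ∈ range (n + 1), ((n.choose j : ℕ) : ℝ) * q ^ j * (1 - q) ^ (n - j) * lawAt P μ j z
        = (1 - q) * ∑ k ∈ range n, ((n.choose (k + 1) : ℕ) : ℝ) * q ^ (k + 1) * (1 - q) ^ (n - (k + 1)) * lawAt P μ (k + 1) z
          + (1 - q) ^ (n + 1) * lawAt P μ 0 z := by
      rw [sum_range_succ']
      simp only [Nat.choose_zero_right, Nat.cast_one, one_mul, pow_zero, Nat.sub_zero]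
      rw [pow_succ]; ring
    rw [h3]; ring

/-- **Masses are binomial averages:** `(μ(qP + (1−q)I)ⁿ)(A) = Σ_j C(n,j)qʲ(1−q)ⁿ⁻ʲ·(μPʲ)(A)`. [ours] -/
theorem mass_partialLazy (P : Y → Y → ℝ) (q : ℝ) (μ : Y → ℝ) (n : ℕ) (A : Finset Y) :
    ∑ z ∈ A, lawAt (fun y z => q * P y z + (1 - q) * (if z = y then 1 else 0)) μ n z
      = ∑ j ∈ range (n + 1), ((n.choose j : ℝ) * q ^ j * (1 - q) ^ (n - j)) * ∑ z ∈ A, lawAt P μ j z := by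
  rw [lawAt_partialLazy_choose]
  simp only []
  rw [sum_comm]
  exact sum_congr rfl fun j _ => by rw [mul_sum]

/-- The binomial weights have mass one. [Mathlib `add_pow`] -/
theorem choose_weights_sum (q : ℝ) (n : ℕ) : ∑ j ∈ range (n + 1), ((n.choose j : ℝ) * q ^ j * (1 - q) ^ (n - j)) = 1 := by
  have h := (add_pow q (1 - q) n).symm
  rw [show q + (1 - q) = 1 by ring, one_pow] at h
  rw [show ∑ j ∈ range (n + 1), ((n.choose j : ℝ) * q ^ j * (1 - q) ^ (n - j)) = ∑ m ∈ range (n + 1), q ^ m * (1 - q) ^ (n - m) * (n.choose m : ℝ) from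
    sum_congr rfl fun j _ => by ring]
  exact h

/-- The binomial weights have mean `nq`. [ours, from `Nat.succ_mul_choose_eq`] -/
theorem choose_weights_mean (q : ℝ) (n : ℕ) : ∑ j ∈ range (n + 1), (j : ℝ) * ((n.choose j : ℝ) * q ^ j * (1 - q) ^ (n - j)) = n * q := by
  cases n with
  | zero => simp
  | succ k =>
    rw [sum_range_succ']
    simp only [Nat.cast_zero, zero_mul, add_zero]
    have hj : ∀ j ∈ range (k + 1), ((j + 1 : ℕ) : ℝ) * ((((k + 1).choose (j + 1) : ℕ) : ℝ) * q ^ (j + 1) * (1 - q) ^ (k + 1 - (j + 1)))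
        = ((k : ℝ) + 1) * q * (((k.choose j : ℕ) : ℝ) * q ^ j * (1 - q) ^ (k - j)) := by
      intro j _
      have h := Nat.add_one_mul_choose_eq k j
      have h' : (((k + 1).choose (j + 1) : ℕ) : ℝ) * ((j : ℝ) + 1) = ((k : ℝ) + 1) * ((k.choose j : ℕ) : ℝ) := by exact_mod_cast h.symm
      rw [show k + 1 - (j + 1) = k - j from by omega, pow_succ]
      push_cast
      linear_combination (q ^ j * (1 - q) ^ (k - j) * q) * h'
    rw [sum_congr rfl hj, ← mul_sum, choose_weights_sum]
    push_cast; ring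

/-- **Markov for the clock:** a binomial average of a non-negative sequence that is `≥ c ≥ 0` up to index `N` is `≥ c·(1 − nq/(N+1))`. [ours] -/
theorem choose_average_ge_of_head {q : ℝ} (hq0 : 0 ≤ q) (hq1 : q ≤ 1) (n : ℕ) {f : ℕ → ℝ} {c : ℝ} {N : ℕ} (hf0 : ∀ j, 0 ≤ f j)
    (hfc : ∀ j, j ≤ N → c ≤ f j) (hc : 0 ≤ c) :
    c * (1 - n * q / ((N : ℝ) + 1)) ≤ ∑ j ∈ range (n + 1), ((n.choose j : ℝ) * q ^ j * (1 - q) ^ (n - j)) * f j := by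
  have hw : ∀ j, 0 ≤ ((n.choose j : ℝ) * q ^ j * (1 - q) ^ (n - j)) := fun j => by
    have : 0 ≤ 1 - q := by linarith
    positivity
  have hpt : ∀ j ∈ range (n + 1), ((n.choose j : ℝ) * q ^ j * (1 - q) ^ (n - j)) * (c * (1 - (j : ℝ) / ((N : ℝ) + 1)))
      ≤ ((n.choose j : ℝ) * q ^ j * (1 - q) ^ (n - j)) * f j := by
    intro j _
    refine mul_le_mul_of_nonneg_left ?_ (hw j)
    by_cases hj : j ≤ N
    · have : 0 ≤ (j : ℝ) / ((N : ℝ) + 1) := by positivity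
      have := hfc j hj; nlinarith
    · have hj' : (N : ℝ) + 1 ≤ j := by exact_mod_cast (by omega : N + 1 ≤ j)
      have : 1 ≤ (j : ℝ) / ((N : ℝ) + 1) := by rw [le_div_iff₀ (by positivity)]; linarith
      have := hf0 j; nlinarith
  refine le_trans (le_of_eq ?_) (sum_le_sum hpt)
  have e : ∀ j ∈ range (n + 1), ((n.choose j : ℝ) * q ^ j * (1 - q) ^ (n - j)) * (c * (1 - (j : ℝ) / ((N : ℝ) + 1)))
      = c * ((n.choose j : ℝ) * q ^ j * (1 - q) ^ (n - j)) - c / ((N : ℝ) + 1) * ((j : ℝ) * ((n.choose j : ℝ) * q ^ j * (1 - q) ^ (n - j))) := by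
    intro j _; ring
  rw [sum_congr rfl e, sum_sub_distrib, ← mul_sum, ← mul_sum, choose_weights_sum, choose_weights_mean]
  ring

/-- **THE EVENT MASS THROUGH THE BINOMIAL CLOCK:** if `(δPʲ)(A) ≥ c ≥ 0` for all `j ≤ N` (`P` row-stochastic, `0 ≤ q ≤ 1`), then
`(δ(qP + (1−q)I)ⁿ)(A) ≥ c(1 − nq/(N+1))`. [ours] -/
theorem partialLazy_mass_ge {P : Y → Y → ℝ} (hP : IsRowStochastic P) {q : ℝ} (hq0 : 0 ≤ q) (hq1 : q ≤ 1) (y₀ : Y) (A : Finset Y) {c : ℝ} (hc : 0 ≤ c) {N : ℕ}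
    (hA : ∀ j, j ≤ N → c ≤ ∑ z ∈ A, lawAt P (Pi.single y₀ 1) j z) (n : ℕ) :
    c * (1 - n * q / ((N : ℝ) + 1)) ≤ ∑ z ∈ A, lawAt (fun y z => q * P y z + (1 - q) * (if z = y then 1 else 0)) (Pi.single y₀ 1) n z := by
  classical
  have hδ : ∀ y, 0 ≤ (Pi.single y₀ (1 : ℝ) : Y → ℝ) y := fun y => by simp only [Pi.single_apply]; split_ifs <;> norm_num
  have h0 : ∀ j, 0 ≤ ∑ z ∈ A, lawAt P (Pi.single y₀ 1) j z := fun j => sum_nonneg fun z _ => lawAt_nonneg hP hδ j z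
  have hhead := choose_average_ge_of_head hq0 hq1 n h0 hA hc
  rw [← mass_partialLazy] at hhead
  exact hhead

omit [DecidableEq Y] in
/-- `qP + (1−q)I` is row-stochastic with `P`. [ours] -/
theorem partialLazy_isRowStochastic {P : Y → Y → ℝ} (hP : IsRowStochastic P) {q : ℝ} (hq0 : 0 ≤ q) (hq1 : q ≤ 1) [DecidableEq Y] :
    IsRowStochastic (fun y z : Y => q * P y z + (1 - q) * (if z = y then 1 else 0)) := by
  refine ⟨fun y z => add_nonneg (mul_nonneg hq0 (hP.1 y z)) (mul_nonneg (by linarith) (by split_ifs <;> norm_num)), fun y => ?_⟩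
  simp only
  rw [sum_add_distrib, ← mul_sum, ← mul_sum, hP.2 y, Finset.sum_ite_eq' univ y]; simp

/-- **THE EVENT FLOOR THROUGH THE BINOMIAL CLOCK:** if `(δPʲ)(A) ≥ c ≥ 0` for all `j ≤ N` (`P` row-stochastic, `0 ≤ q ≤ 1`) and `π` has unit mass, then
`‖δ(qP + (1−q)I)ⁿ − π‖_TV ≥ c(1 − nq/(N+1)) − π(A)`. [ours] -/
theorem partialLazy_tvDist_ge {P : Y → Y → ℝ} (hP : IsRowStochastic P) {q : ℝ} (hq0 : 0 ≤ q) (hq1 : q ≤ 1) (y₀ : Y) (A : Finset Y) {π : Y → ℝ}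
    (hπ1 : ∑ y, π y = 1) {c : ℝ} (hc : 0 ≤ c) {N : ℕ} (hA : ∀ j, j ≤ N → c ≤ ∑ z ∈ A, lawAt P (Pi.single y₀ 1) j z) (n : ℕ) :
    c * (1 - n * q / ((N : ℝ) + 1)) - ∑ z ∈ A, π z ≤ tvDist (lawAt (fun y z => q * P y z + (1 - q) * (if z = y then 1 else 0)) (Pi.single y₀ 1) n) π := by
  classical
  have hhead := partialLazy_mass_ge hP hq0 hq1 y₀ A hc hA n
  have hl1 : ∑ z, lawAt (fun y z : Y => q * P y z + (1 - q) * (if z = y then 1 else 0)) (Pi.single y₀ 1) n z = ∑ z, π z := by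
    rw [sum_lawAt (partialLazy_isRowStochastic hP hq0 hq1), Finset.sum_pi_single', if_pos (mem_univ _), hπ1]
  have htv := sub_sum_le_tvDist hl1 A
  linarith only [hhead, htv]

/-- `s ≥ 260 ⇒ (64s + 36)/s² ≤ ¼`. [ours] -/
theorem quarter_of_ge_260 {s : ℝ} (hs : 260 ≤ s) : (64 * s + 36) / s ^ 2 ≤ 1 / 4 := by
  have hs0 : 0 < s := by linarith
  rw [div_le_div_iff₀ (by positivity) (by norm_num)]
  nlinarith

end PartialLazy

end Summit.Ventures.LatticeQCDFlow.Scaling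

end
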